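import Mathlib
import Summits.Ventures.PercRepro.TriangleCapRowA2CapRef

/-!
# PercRepro — TOWARDS EVERY CELL `(k, a, a + j)`: THE JOINT ACCOUNTING AT A GENERAL DEFICIT `δ` (p3, gen 48; part 202a)

The lemmas of parts 200x / 200zj with the deficit `δ` of the cell `r = a + δ − 2` as a parameter (at `M = 1`:
`Σ_R δ_u = δ`, `a + δ − 1` misses of `R` into `N`): `Σ_R (degIn N)² + 2δ (K − 1) + δ n₊ ≤ |R| (K − 1)² + δ (δ + 1)`
(`capGen_R_sum`: each positive deficit is at most `δ + 1 − n₊`), at most `δ` deficit vertices (`capGen_np_le`), the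
loss on `N` at least `δ (a − 1 − n₊)` (`capGen_N_sum`: the non-ends are missed at most `n₊` times each and pay
`a − 1 − n₊` per miss, the two ends pay `e (a − 1 − e) ≥ e (a − 1 − n₊)` for their excess `e ≤ n₊`), and the arithmetic
against the `(j + 1)`-broom gap `2 (k − a − 3) + 2j (a − 2)`, `j = δ − 2`: slack `2a − 2j − 8` for every `a ≥ j + 4`
(`capGen_sq_arith`, `K ≥ 2a + j`). Axioms: standard.
-/

namespace PercRepro

namespace TriangleCap

namespace C047

open Finset

variable {V : Type*} [DecidableEq V]

/-- **THE `R`-SUM AT `M = 1` AND DEFICIT `δ`:** every `u ∈ R` at `≤ K − 1`, `Σ_R degIn N + δ = |R| (K − 1)` ⇒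
`Σ_R (degIn N)² + 2δ (K − 1) + δ n₊ ≤ |R| (K − 1)² + δ (δ + 1)` with `n₊ = #{u ∈ R : degIn N u + 2 ≤ K}`: the deficits
`δ_u = K − 1 − degIn N u` sum to `δ`, each positive one is at most `δ + 1 − n₊`, so `Σ δ_u² ≤ (δ + 1 − n₊) Σ δ_u`. -/
theorem capGen_R_sum (D : SimpleGraph V) [DecidableRel D.Adj] (R N : Finset V) (K δ : ℕ)
    (hPle : ∀ u ∈ R, degIn D N u + 1 ≤ K) (hsum : ∑ u ∈ R, degIn D N u + δ = R.card * (K - 1)) :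
    ∑ u ∈ R, degIn D N u * degIn D N u + 2 * δ * (K - 1) +
        δ * (R.filter (fun u => degIn D N u + 2 ≤ K)).card ≤
      R.card * ((K - 1) * (K - 1)) + δ * (δ + 1) := by
  have hδ : ∀ u ∈ R, degIn D N u + (K - 1 - degIn D N u) = K - 1 := fun u hu => by
    have := hPle u hu
    omega
  have hsumδ : ∑ u ∈ R, (K - 1 - degIn D N u) = δ := by
    have h : ∑ u ∈ R, (degIn D N u + (K - 1 - degIn D N u)) = ∑ _u ∈ R, (K - 1) := sum_congr rfl hδ
    rw [sum_add_distrib, sum_const, smul_eq_mul] at h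
    omega
  obtain ⟨Rp, hRp⟩ : ∃ Rp : Finset V, Rp = R.filter (fun u => degIn D N u + 2 ≤ K) := ⟨_, rfl⟩
  rw [← hRp]
  have hRpsub : Rp ⊆ R := by
    rw [hRp]
    exact filter_subset _ _
  have hRppos : ∀ u ∈ Rp, 1 ≤ K - 1 - degIn D N u := fun u hu => by
    rw [hRp, mem_filter] at hu
    omega
  have hsumRp : ∑ u ∈ Rp, (K - 1 - degIn D N u) ≤ δ := by
    rw [← hsumδ]
    exact sum_le_sum_of_subset_of_nonneg hRpsub (fun _ _ _ => Nat.zero_le _)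
  -- each positive deficit is at most `δ + 1 − n₊`
  have hmax : ∀ u ∈ R, (K - 1 - degIn D N u) * (K - 1 - degIn D N u) + Rp.card * (K - 1 - degIn D N u) ≤
      (δ + 1) * (K - 1 - degIn D N u) := by
    intro u hu
    by_cases h0 : K - 1 - degIn D N u = 0
    · rw [h0]
      simp
    · have huRp : u ∈ Rp := by
        rw [hRp, mem_filter]
        exact ⟨hu, by omega⟩
      have h1 := add_sum_erase Rp (fun w => K - 1 - degIn D N w) huRp
      have h2 : ∑ _w ∈ Rp.erase u, 1 ≤ ∑ w ∈ Rp.erase u, (K - 1 - degIn D N w) :=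
        sum_le_sum (fun w hw => hRppos w (mem_of_mem_erase hw))
      rw [sum_const, smul_eq_mul, mul_one, card_erase_of_mem huRp] at h2
      have h3 : (K - 1 - degIn D N u) + Rp.card ≤ δ + 1 := by omega
      have h4 : (K - 1 - degIn D N u) * ((K - 1 - degIn D N u) + Rp.card) ≤ (K - 1 - degIn D N u) * (δ + 1) :=
        Nat.mul_le_mul_left _ h3
      nlinarith [h4]
  have hsq : ∀ u ∈ R, degIn D N u * degIn D N u + 2 * (K - 1) * (K - 1 - degIn D N u) =
      (K - 1) * (K - 1) + (K - 1 - degIn D N u) * (K - 1 - degIn D N u) := fun u hu =>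
    rowA1_delta_sq _ _ _ (hδ u hu)
  have hS1 : ∑ u ∈ R, degIn D N u * degIn D N u + 2 * (K - 1) * δ =
      R.card * ((K - 1) * (K - 1)) + ∑ u ∈ R, (K - 1 - degIn D N u) * (K - 1 - degIn D N u) := by
    have h := sum_congr rfl hsq
    rw [sum_add_distrib, sum_add_distrib, sum_const, smul_eq_mul, ← mul_sum, hsumδ] at h
    exact h
  have hS2 : ∑ u ∈ R, (K - 1 - degIn D N u) * (K - 1 - degIn D N u) + Rp.card * δ ≤ (δ + 1) * δ := by
    have h := sum_le_sum hmax
    rw [sum_add_distrib, ← mul_sum, ← mul_sum, hsumδ] at h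
    exact h
  have e1 : 2 * δ * (K - 1) = 2 * (K - 1) * δ := by ring
  have e2 : δ * Rp.card = Rp.card * δ := by ring
  have e3 : δ * (δ + 1) = (δ + 1) * δ := by ring
  rw [e1, e2, e3]
  omega

omit [DecidableEq V] in
/-- At most `δ` vertices of `R` have a deficit: `#{u ∈ R : degIn N u + 2 ≤ K} ≤ δ`. -/
theorem capGen_np_le (D : SimpleGraph V) [DecidableRel D.Adj] (R N : Finset V) (K δ : ℕ)
    (hPle : ∀ u ∈ R, degIn D N u + 1 ≤ K) (hsum : ∑ u ∈ R, degIn D N u + δ = R.card * (K - 1)) :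
    (R.filter (fun u => degIn D N u + 2 ≤ K)).card ≤ δ := by
  have hδ : ∀ u ∈ R, degIn D N u + (K - 1 - degIn D N u) = K - 1 := fun u hu => by
    have := hPle u hu
    omega
  have hsumδ : ∑ u ∈ R, (K - 1 - degIn D N u) = δ := by
    have h : ∑ u ∈ R, (degIn D N u + (K - 1 - degIn D N u)) = ∑ _u ∈ R, (K - 1) := sum_congr rfl hδ
    rw [sum_add_distrib, sum_const, smul_eq_mul] at h
    omega
  have h1 : ∑ _u ∈ R.filter (fun u => degIn D N u + 2 ≤ K), 1 ≤
      ∑ u ∈ R.filter (fun u => degIn D N u + 2 ≤ K), (K - 1 - degIn D N u) :=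
    sum_le_sum (fun u hu => by
      rw [mem_filter] at hu
      omega)
  have h2 : ∑ u ∈ R.filter (fun u => degIn D N u + 2 ≤ K), (K - 1 - degIn D N u) ≤
      ∑ u ∈ R, (K - 1 - degIn D N u) :=
    sum_le_sum_of_subset_of_nonneg (filter_subset _ _) (fun _ _ _ => Nat.zero_le _)
  rw [sum_const, smul_eq_mul, mul_one] at h1
  omega

variable [Fintype V]

/-- **THE `N`-SUM AT `M = 1` AND DEFICIT `δ`** (`|R| = a − 1`): with `d(y) = 1 + f(y) + g(y)`, `f ≤ 1`, `Σ_N f = 2`,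
`Σ_N g = P`, `2 Σ_N fg ≤ 2 (a − 1)`, `P + (a + δ − 1) + K = aK` (the `a + δ − 1` misses), `|N| = K`, every non-end
missed by at most `n₊` vertices of `R` and the two ends missed `≤ (a − 1) + n₊` times in all:
`Σ_N d² + δ (a − 1 − n₊) ≤ K + 6 + (a + 1) P + 2 (a − 1)`. -/
theorem capGen_N_sum (D : SimpleGraph V) [DecidableRel D.Adj] (N R : Finset V) (K a P np δ : ℕ)
    (ha : 5 ≤ a) (hKdef : N.card = K) (hRcard : R.card + 1 = a)
    (hdegN : ∀ y ∈ N, deg D y = 1 + degIn D N y + degIn D R y) (hf1 : ∀ y ∈ N, degIn D N y ≤ 1)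
    (hTf : ∑ y ∈ N, degIn D N y = 2) (hPdef : ∑ y ∈ N, degIn D R y = P)
    (hfg_le : 2 * ∑ y ∈ N, degIn D N y * degIn D R y ≤ 2 * (a - 1))
    (hP : P + (a + δ - 1) + K = a * K)
    (hNE : ∀ y ∈ N, degIn D N y = 0 → a - 1 - degIn D R y ≤ np)
    (hE2 : ∀ y₁ ∈ N, ∀ y₂ ∈ N, y₁ ≠ y₂ → degIn D N y₁ = 1 → degIn D N y₂ = 1 →
      (a - 1 - degIn D R y₁) + (a - 1 - degIn D R y₂) ≤ (a - 1) + np) :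
    ∑ y ∈ N, deg D y * deg D y + δ * (a - 1 - np) ≤ K + 6 + (a + 1) * P + 2 * (a - 1) := by
  have hg : ∀ y ∈ N, degIn D R y + 1 ≤ a := fun y _ => by
    have := degIn_le_card D R y
    omega
  have hid : ∀ y ∈ N, deg D y * deg D y + degIn D R y * (a - 1 - degIn D R y) =
      1 + 3 * degIn D N y + (a + 1) * degIn D R y + 2 * (degIn D N y * degIn D R y) := fun y hy => by
    rw [hdegN y hy]
    exact rowA_vertex_identity _ _ _ (hf1 y hy) (hg y hy)
  have hsumid : ∑ y ∈ N, deg D y * deg D y + ∑ y ∈ N, degIn D R y * (a - 1 - degIn D R y) =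
      K + 3 * 2 + (a + 1) * P + 2 * ∑ y ∈ N, degIn D N y * degIn D R y := by
    rw [← sum_add_distrib, sum_congr rfl hid, sum_add_distrib, sum_add_distrib, sum_add_distrib, sum_const,
      smul_eq_mul, mul_one, ← mul_sum, ← mul_sum, ← mul_sum, hKdef, hTf, hPdef]
  obtain ⟨S₀, hS₀⟩ : ∃ S₀ : Finset V, S₀ = N.filter (fun y => degIn D N y = 0) := ⟨_, rfl⟩
  obtain ⟨S₁, hS₁⟩ : ∃ S₁ : Finset V, S₁ = N.filter (fun y => ¬ degIn D N y = 0) := ⟨_, rfl⟩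
  have hS₁card : S₁.card = 2 := by
    have h : ∑ y ∈ N, degIn D N y = ∑ y ∈ S₁, 1 := by
      rw [hS₁, sum_filter]
      apply sum_congr rfl
      intro y hy
      have := hf1 y hy
      split_ifs with h <;> omega
    rw [hTf, sum_const, smul_eq_mul, mul_one] at h
    exact h.symm
  have hS₀card : S₀.card + 2 = K := by
    have := card_filter_add_card_filter_not (s := N) (fun y => degIn D N y = 0)
    rw [← hS₀, ← hS₁, hS₁card, hKdef] at this
    exact this
  have hfg : ∑ y ∈ N, degIn D N y * degIn D R y = ∑ y ∈ S₁, degIn D R y := by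
    rw [hS₁, sum_filter]
    apply sum_congr rfl
    intro y hy
    have := hf1 y hy
    by_cases h : degIn D N y = 0
    · rw [if_neg (fun h' => h' h), h, zero_mul]
    · have h1 : degIn D N y = 1 := by omega
      rw [h1, if_pos (by omega), one_mul]
  have hgsplit : ∑ y ∈ N, degIn D R y = ∑ y ∈ S₀, degIn D R y + ∑ y ∈ S₁, degIn D R y := by
    rw [hS₀, hS₁, sum_filter_add_sum_filter_not]
  have hLsplit : ∑ y ∈ N, degIn D R y * (a - 1 - degIn D R y) =
      ∑ y ∈ S₀, degIn D R y * (a - 1 - degIn D R y) + ∑ y ∈ S₁, degIn D R y * (a - 1 - degIn D R y) := by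
    rw [hS₀, hS₁, sum_filter_add_sum_filter_not]
  have hmiss : ∑ y ∈ S₀, (a - 1 - degIn D R y) + ∑ y ∈ S₀, degIn D R y = S₀.card * (a - 1) := by
    rw [← sum_add_distrib]
    have h : ∀ y ∈ S₀, (a - 1 - degIn D R y) + degIn D R y = a - 1 := fun y hy => by
      have := hg y (mem_of_mem_filter y (hS₀ ▸ hy))
      omega
    rw [sum_congr rfl h, sum_const, smul_eq_mul]
  obtain ⟨y₁, y₂, hne, hS₁eq⟩ := card_eq_two.mp hS₁card
  have hy₁S₁ : y₁ ∈ S₁ := by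
    rw [hS₁eq]
    exact mem_insert_self _ _
  have hy₂S₁ : y₂ ∈ S₁ := by
    rw [hS₁eq]
    exact mem_insert_of_mem (mem_singleton_self _)
  have hy₁N : y₁ ∈ N := by
    rw [hS₁] at hy₁S₁
    exact mem_of_mem_filter _ hy₁S₁
  have hy₂N : y₂ ∈ N := by
    rw [hS₁] at hy₂S₁
    exact mem_of_mem_filter _ hy₂S₁
  have hf₁ : degIn D N y₁ = 1 := by
    have h := hy₁S₁
    rw [hS₁, mem_filter] at h
    have := hf1 y₁ hy₁N
    omega
  have hf₂ : degIn D N y₂ = 1 := by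
    have h := hy₂S₁
    rw [hS₁, mem_filter] at h
    have := hf1 y₂ hy₂N
    omega
  have hS₁g : ∑ y ∈ S₁, degIn D R y = degIn D R y₁ + degIn D R y₂ := by rw [hS₁eq, sum_pair hne]
  have hS₁L : ∑ y ∈ S₁, degIn D R y * (a - 1 - degIn D R y) =
      degIn D R y₁ * (a - 1 - degIn D R y₁) + degIn D R y₂ * (a - 1 - degIn D R y₂) := by
    rw [hS₁eq, sum_pair hne]
  have hg₁ := hg y₁ hy₁N
  have hg₂ := hg y₂ hy₂N
  have hmiss2 : ∑ y ∈ S₀, (a - 1 - degIn D R y) + (a - 1 - degIn D R y₁ - degIn D R y₂) = δ := by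
    obtain ⟨K', hK'⟩ : ∃ K', K = K' + 2 := ⟨K - 2, by omega⟩
    have hS₀' : S₀.card = K' := by omega
    rw [hS₀'] at hmiss
    rw [hK'] at hP
    rw [hfg, hS₁g] at hfg_le
    rw [hgsplit, hS₁g] at hPdef
    have e1 : K' * (a - 1) + K' = K' * a := by
      rw [← Nat.mul_succ]
      congr 1
      omega
    have e2 : a * (K' + 2) = K' * a + 2 * a := by ring
    omega
  -- the non-ends: each missed at most `np` times, the loss `(a − 1 − np)` per miss
  have hloss : (a - 1 - np) * ∑ y ∈ S₀, (a - 1 - degIn D R y) ≤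
      ∑ y ∈ S₀, degIn D R y * (a - 1 - degIn D R y) := by
    rw [mul_sum]
    apply sum_le_sum
    intro y hy
    have hyN : y ∈ N := mem_of_mem_filter y (hS₀ ▸ hy)
    have hy0 : degIn D N y = 0 := by
      have h := hy
      rw [hS₀, mem_filter] at h
      exact h.2
    have hle : a - 1 - degIn D R y ≤ np := hNE y hyN hy0
    have := hg y hyN
    exact Nat.mul_le_mul_right _ (by omega)
  -- the two ends
  have hfg_le' : degIn D R y₁ + degIn D R y₂ ≤ a - 1 := by
    rw [hfg, hS₁g] at hfg_le
    omega
  obtain ⟨e, he⟩ : ∃ e, (a - 1 - degIn D R y₁) + (a - 1 - degIn D R y₂) = a - 1 + e :=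
    ⟨(a - 1 - degIn D R y₁) + (a - 1 - degIn D R y₂) - (a - 1), by omega⟩
  have hen : e ≤ np := by
    have := hE2 y₁ hy₁N y₂ hy₂N hne hf₁ hf₂
    omega
  have hends := rowA1_ends_loss_ref (a - 1 - degIn D R y₁) (a - 1 - degIn D R y₂) e a (by omega) (by omega) he
  have eg₁ : a - 1 - (a - 1 - degIn D R y₁) = degIn D R y₁ := by omega
  have eg₂ : a - 1 - (a - 1 - degIn D R y₂) = degIn D R y₂ := by omega
  rw [eg₁, eg₂] at hends
  have hends' : e * (a - 1 - np) ≤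
      degIn D R y₁ * (a - 1 - degIn D R y₁) + degIn D R y₂ * (a - 1 - degIn D R y₂) := by
    have h1 : (a - 1 - degIn D R y₁) * degIn D R y₁ = degIn D R y₁ * (a - 1 - degIn D R y₁) := mul_comm _ _
    have h2 : (a - 1 - degIn D R y₂) * degIn D R y₂ = degIn D R y₂ * (a - 1 - degIn D R y₂) := mul_comm _ _
    rw [h1, h2] at hends
    have h3 : e * (a - 1 - np) ≤ e * (a - 1 - e) := Nat.mul_le_mul_left _ (by omega)
    omega
  have hsum3 : ∑ y ∈ S₀, (a - 1 - degIn D R y) + e = δ := by omega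
  have hL : δ * (a - 1 - np) ≤ ∑ y ∈ N, degIn D R y * (a - 1 - degIn D R y) := by
    rw [hLsplit, hS₁L]
    have h3 : δ * (a - 1 - np) = (a - 1 - np) * ∑ y ∈ S₀, (a - 1 - degIn D R y) + e * (a - 1 - np) := by
      rw [← hsum3]
      ring
    omega
  rw [hfg, hS₁g] at hsumid
  omega

/-- **THE ARITHMETIC OF `M = 1` AT `r = a + j`, `δ = j + 2`:** `a ≥ j + 4`, `n₊ ≤ j + 2`, `K ≥ 2a + j`,
`m + (a + j) = aK`, `P + (a + j + 1) + K = aK`, `S_N + (j + 2)(a − 1 − n₊) ≤ K + 6 + (a + 1) P + 2 (a − 1)`,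
`S_R + 2 (j + 2)(K − 1) + (j + 2) n₊ ≤ (a − 1)(K − 1)² + (j + 2)(j + 3)` ⇒
`K² + S_N + S_R + (a + j)(k − 1 − (a + j)) + (2 (k − a − 3) + 2j (a − 2)) ≤ m k`, `k = K + a`; slack `2a − 2j − 8`. -/
theorem capGen_sq_arith (a j K P SN SR np m : ℕ) (ha : j + 4 ≤ a) (hn : np ≤ j + 2) (hK : 2 * a + j ≤ K)
    (hm : m + (a + j) = a * K) (hP : P + (a + j + 1) + K = a * K)
    (hSN : SN + (j + 2) * (a - 1 - np) ≤ K + 6 + (a + 1) * P + 2 * (a - 1))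
    (hSR : SR + 2 * (j + 2) * (K - 1) + (j + 2) * np ≤ (a - 1) * ((K - 1) * (K - 1)) + (j + 2) * (j + 3)) :
    K * K + SN + SR + (a + j) * (K + a - 1 - (a + j)) + (2 * (K + a - a - 3) + 2 * j * (a - 2)) ≤ m * (K + a) := by
  obtain ⟨q, rfl⟩ : ∃ q, a = q + j + 4 := ⟨a - (j + 4), by omega⟩
  obtain ⟨t, rfl⟩ : ∃ t, K = 2 * (q + j + 4) + j + t := ⟨K - (2 * (q + j + 4) + j), by omega⟩
  obtain ⟨u, hu⟩ : ∃ u, q + j + 4 - 1 - np = u := ⟨_, rfl⟩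
  have hu' : np + u = q + j + 3 := by omega
  have e1 : 2 * (q + j + 4) + j + t + (q + j + 4) - 1 - (q + j + 4 + j) = 2 * q + 2 * j + t + 7 := by omega
  have e2 : 2 * (q + j + 4) + j + t + (q + j + 4) - (q + j + 4) - 3 = 2 * q + 3 * j + t + 5 := by omega
  have e3 : q + j + 4 - 2 = q + j + 2 := by omega
  have e4 : q + j + 4 - 1 = q + j + 3 := by omega
  have e5 : 2 * (q + j + 4) + j + t - 1 = 2 * q + 3 * j + t + 7 := by omega
  rw [e1, e2, e3]
  rw [hu, e4] at hSN
  rw [e4, e5] at hSR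
  zify at hSN hSR hm hP hu' ⊢
  have hmZ : (m : ℤ) = (q + j + 4) * (2 * (q + j + 4) + j + t) - (q + j + 4 + j) := by linarith
  have hPZ : (P : ℤ) = (q + j + 4) * (2 * (q + j + 4) + j + t) - (q + j + 4 + j + 1) - (2 * (q + j + 4) + j + t) := by
    linarith
  have hnpZ : (np : ℤ) = q + j + 3 - u := by linarith
  rw [hmZ]
  rw [hPZ] at hSN
  rw [hnpZ] at hSR
  linarith [hSN, hSR]

end C047

end TriangleCap

end PercRepro
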